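import Literature.NumberTheory.PAdicHodge.BmaxPlusTransportedPeriodNondegenerate
import Literature.NumberTheory.PAdicHodge.BmaxPlusTransportedPeriodHomsBdR
import Literature.NumberTheory.PAdicHodge.BmaxPlusTDivisibilityAllPrimes
import HarnessLib

/-!
# The transported Legendre determinant: `φD = pD`, `θ(D) = 0` from the Hodge line, hence `p^k·D = c·t` with `c ∈ ℤ_p`; and
# `hne` for the cells' Hodge pair reduces to `D ≢ 0`

Topic `Literature/NumberTheory/PAdicHodge` (theorems only; no definition, no named fact, no instance, no `sorry`). Sequel of
`BmaxPlusTransportedPeriodHom(sBdR)` (honest `LT`, `P⁰ = f∘LT`, `Q⁰ = f∘φ∘LT` on `T_pŴ_D`) and `BmaxPlusTransportedPeriodNondegenerate`.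
For `S, U ∈ T_pŴ_D` the **transported Legendre determinant** is `D(S,U) := LT S·φ(LT U) − φ(LT S)·LT U ∈ A_max`.

* §0 ★ `bmaxPlusToBdR_injective` — **the comparison `B_max⁺ → B_dR⁺` is injective** (`ker θ_{A_max} = (ξ/p)`, `⋂ₖ(ξ/p)ᵏA_max = 0`, `f(ξ/p) ≠ 0`);
* §1 (algebra, private) `sub_mul_eq_zero_of_two_solutions` — two linear equations `A a + B b = 0 = A a' + B b'` with `(A, B) ≠ 0` force `a b' − b a' = 0`;
  `exists_add_mul_ne_zero_of_det_ne_zero` — conversely a nonzero `2 × 2` minor of `(P, Q)` forces `A·P + B·Q ≢ 0`.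
* §2 ★ `frobBmaxPlus_transport_det` — **`φD = pD`** (both columns solve Honda's equation, `frobBmaxPlus_hondaTrace_transport_eq_zero`,
  `PadicLogSeries.frob_det_eq_mul_det`); ★★ `exists_pow_mul_transport_det_eq_tBmax` — **if `θ(D) = 0` then `p^k·D = ι(c)·t`**, `c ∈ ℤ_p`
  (Fontaine's lemma `fontaineKernel'`, all primes); `exists_pow_mul_transported_det_eq_tBdR` — the same through `f` for `P⁰, Q⁰`:
  `p^k·(P⁰S·Q⁰U − Q⁰S·P⁰U) = c·t_dR`.
* §3 `thetaBdR_transported_det_eq_zero_of_hodgeLine` — the (HL-eval) identity on torsion towers in the form `a·θ(P⁰τ) + b·θ(Q⁰τ) = 0` for all `τ`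
  with `(a, b) ≠ 0` gives `θ(P⁰S·Q⁰U − Q⁰S·P⁰U) = 0`; with §2 the capstone's constant `c_L` for the cells is `ℚ_p`-RATIONAL exactly as for the
  φ-road (`BmaxPlusPhiRoadReciprocity.exists_sq_mul_phiRoad_det_eq`).
* §4 `exists_hodgePair_ne_zero_of_det_ne_zero` — **`hne` ⟸ `D ≢ 0`**: if some minor `P⁰S·Q⁰U − Q⁰S·P⁰U ≠ 0` then `A·P⁰ + B·Q⁰ ≢ 0` for every
  `(A, B) ≠ 0`; `exists_transported_P₀_ne_zero` — the case `B = 0` is free: `P⁰ τ ≠ 0` for every `τ ≠ 0` (non-degeneracy: `θ(LT τ) = 0` and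
  `θ(φ LT τ) = 0` cannot both hold).

Purpose (line `kato_lever`, crux K★ `stmt-BirchSwinnertonDyer-22226`, memo `Lines/kato-lever-K2-transported-period-hom.md` §2–§3): T5 needs `ι(c_L) ∈ ℚ_p`
(here) and `hne`; the latter is now equivalent to the non-vanishing of the transported Legendre determinant, whose only known route for `B ≠ 0` is
the injectivity of `F ⊗_{F₀} B_max⁺ → B_dR⁺` (Fontaine) — NOT in this file. BSD / K★ are NOT proved by any of this.

## References
* J.-M. Fontaine, *Le corps des périodes p-adiques*, Astérisque 223 (1994), Exp. II §1.5, Exp. III Th. 5.3.7. [FontaineAsterisque223III]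
* P. Colmez, *Périodes p-adiques des variétés abéliennes*, Math. Ann. 292 (1992), §2. [Colmez1992PeriodesAbeliennes]
* K. Kato, LNM 1553 (1993), Ch. II §1.4. [Kato1993LNM1553]
-/

noncomputable section

open Ideal WittVector ValuativeRel Field
open scoped Classical

namespace Literature.NumberTheory.PAdicHodge

open Literature.NumberTheory.GaloisRepresentations Literature.NumberTheory.GaloisRepresentations.IsNonarchimedeanLocalField
open Literature.NumberTheory.GaloisRepresentations.LubinTate Literature.NumberTheory.EllipticCurves
open Literature.RingTheory.FormalGroups

/-! ## §0 `B_max⁺ → B_dR⁺` is injective -/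

section Injective

variable {F : Type} [Field F] [ValuativeRel F] [TopologicalSpace F] [IsNonarchimedeanLocalField F] [CharZero F]
  {p : ℕ} [Fact p.Prime] [Fact (¬ IsUnit (p : integerC F))] [IsAdicComplete (Ideal.span {(p : integerC F)}) (integerC F)]

set_option maxHeartbeats 1600000 in
/-- `f(ξ/p) ≠ 0` in `B_dR⁺`: `p·f(ξ/p) = f(ι ξ) = ξ_dR ≠ 0`. [cite: Colmez1998Annals, §III.2] -/
theorem bmaxPlusToBdR_omegaB_ne_zero (hF : Function.Surjective (fontaineTheta (integerC F) p)) :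
    bmaxPlusToBdR F p (algebraMap (bmaxZero F p) (BmaxPlus F p) omegaB) ≠ 0 := by
  haveI := isDomain_bDeRhamPlus (F := F) (p := p) hF
  intro h
  have e : ainfToBmaxPlus F p xi = (p : BmaxPlus F p) * algebraMap (bmaxZero F p) (BmaxPlus F p) omegaB := by
    change algebraMap (bmaxZero F p) (BmaxPlus F p) (algebraMap (Ainf (p := p) F) (bmaxZero F p) xi) = _
    rw [← natCast_mul_omegaB, map_mul, map_natCast]
  have h1 : bmaxPlusToBdR F p (ainfToBmaxPlus F p xi) = 0 := by
    rw [e, map_mul, map_natCast, h, mul_zero]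
  rw [bmaxPlusToBdR_ainfToBmaxPlus, ainfToBdR_xi] at h1
  exact one_ne_zero (eq_zero_of_xiBdR_mul_eq_zero (F := F) (p := p) (x := 1) (by rw [h1, zero_mul]))

set_option maxHeartbeats 1600000 in
/-- ★ **The comparison `B_max⁺(F) → B_dR⁺(F)` is injective** (`θ` surjective). If `f(x) = 0` then `θ(x) = θ_dR(f x) = 0`, so `x = (ξ/p)·x₁`
(`exists_eq_omegaB_mul_of_thetaBmaxPlus_eq_zero`) with `f(x₁) = 0` again (`f(ξ/p) ≠ 0`, `B_dR⁺` a domain); hence `x ∈ ⋂ₖ (ξ/p)ᵏA_max = 0`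
(`eq_zero_of_forall_exists_eq_omegaB_pow_mul`). [cite: Colmez1998Annals, §III.2] [cite: FontaineAsterisque223III, Exp. III §1.5] -/
theorem bmaxPlusToBdR_injective (hF : Function.Surjective (fontaineTheta (integerC F) p)) : Function.Injective (bmaxPlusToBdR F p) := by
  haveI := isDomain_bDeRhamPlus (F := F) (p := p) hF
  rw [injective_iff_map_eq_zero]
  intro x hx
  have key : ∀ k : ℕ, ∃ zk : BmaxPlus F p, x = algebraMap (bmaxZero F p) (BmaxPlus F p) omegaB ^ k * zk ∧ bmaxPlusToBdR F p zk = 0 := by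
    intro k
    induction k with
    | zero => exact ⟨x, by rw [pow_zero, one_mul], hx⟩
    | succ k ih =>
      obtain ⟨zk, hzk, hfzk⟩ := ih
      have hθ : thetaBmaxPlus F p zk = 0 :=
        Subtype.ext (by rw [← thetaBdR_bmaxPlusToBdR, hfzk, map_zero]; rfl)
      obtain ⟨y, hy⟩ := exists_eq_omegaB_mul_of_thetaBmaxPlus_eq_zero hF hθ
      have hfy : bmaxPlusToBdR F p y = 0 := by
        rw [hy, map_mul] at hfzk
        exact (mul_eq_zero.1 hfzk).resolve_left (bmaxPlusToBdR_omegaB_ne_zero hF)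
      exact ⟨y, by rw [hzk, hy, pow_succ, mul_assoc], hfy⟩
  exact eq_zero_of_forall_exists_eq_omegaB_pow_mul fun k => (key k).imp fun zk h => h.1

end Injective

/-! ## §1 Two-by-two linear algebra -/

/-- Two solutions `A a + B b = 0`, `A a' + B b' = 0` with `(A, B) ≠ 0` force the minor `a b' − b a'` to vanish (no zero divisors). [folklore] -/
private theorem sub_mul_eq_zero_of_two_solutions {R : Type*} [CommRing R] [NoZeroDivisors R] {A B a b a' b' : R}
    (h : A * a + B * b = 0) (h' : A * a' + B * b' = 0) (hAB : A ≠ 0 ∨ B ≠ 0) : a * b' - b * a' = 0 := by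
  rcases hAB with hA | hB
  · have e : A * (a * b' - b * a') = (A * a + B * b) * b' - (A * a' + B * b') * b := by ring
    rw [h, h', zero_mul, zero_mul, sub_zero] at e
    exact (mul_eq_zero.1 e).resolve_left hA
  · have e : B * (a * b' - b * a') = (A * a' + B * b') * a - (A * a + B * b) * a' := by ring
    rw [h, h', zero_mul, zero_mul, sub_zero] at e
    exact (mul_eq_zero.1 e).resolve_left hB

/-- A nonzero minor `P S·Q U − Q S·P U ≠ 0` forces `A·P + B·Q ≢ 0` for every `(A, B) ≠ 0`. [folklore] -/
private theorem exists_add_mul_ne_zero_of_det_ne_zero {T R : Type*} [CommRing R] [NoZeroDivisors R] (P Q : T → R) {A B : R} (hAB : A ≠ 0 ∨ B ≠ 0)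
    {S U : T} (hdet : P S * Q U - Q S * P U ≠ 0) : ∃ τ, A * P τ + B * Q τ ≠ 0 := by
  by_contra h
  push Not at h
  exact hdet (sub_mul_eq_zero_of_two_solutions (h S) (h U) hAB)

/-! ## §2 The transported Legendre determinant: `φD = pD`, and `p^k D = c·t` when `θ(D) = 0` -/

section Transported

variable {F : Type} [Field F] [ValuativeRel F] [TopologicalSpace F] [IsNonarchimedeanLocalField F] [CharZero F]
  {p : ℕ} [hpp : Fact p.Prime] [Fact (¬ IsUnit (p : integerC F))] [IsAdicComplete (Ideal.span {(p : integerC F)}) (integerC F)]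
  {hp : valuation F p < 1} (D : EisensteinRoot F p hp) {hθ : Function.Surjective (fontaineTheta (integerC F) p)}
  (W : WeierstrassCurve (EisensteinRoot.CoeffDisc D)) (E₀ : WeierstrassCurve ℤ)
  (hWE : W.map (Ideal.Quotient.mk (Ideal.span {EisensteinRoot.CoeffDisc.of D (AdjoinRoot.root D.poly)})) =
    (E₀.map (algebraMap ℤ (EisensteinRoot.CoeffDisc D))).map
      (Ideal.Quotient.mk (Ideal.span {EisensteinRoot.CoeffDisc.of D (AdjoinRoot.root D.poly)})))
  (ψ : EisensteinRoot.CoeffDisc D →+* LTCoeff F) (hψ : ∀ c, algebraMap (LTCoeff F) F (ψ c) = EisensteinRoot.CoeffDisc.toF D c)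

include hWE hψ in
set_option maxHeartbeats 1600000 in
/-- ★ **`φD = pD`** for the transported Legendre determinant `D = LT S·φ(LT U) − φ(LT S)·LT U` (both columns solve Honda's equation
`φ²X − a_pφX + pX = 0`, `frobBmaxPlus_hondaTrace_transport_eq_zero`; `PadicLogSeries.frob_det_eq_mul_det`).
[cite: Colmez1992PeriodesAbeliennes, §2] [cite: FontaineAsterisque223III, Exp. III Th. 5.3.7] -/
theorem frobBmaxPlus_transport_det [(E₀.map (Int.castRingHom ℚ_[p])).IsElliptic] [(E₀.map (Int.castRingHom (ZMod p))).IsElliptic]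
    {N : ℕ} (hN : D.e ≤ N) {LT : AinfTop.TatePtO F (W.map ψ) p →+ BmaxPlus F p}
    (hLT : ∀ (τ : AinfTop.TatePtO F (W.map ψ) p) (w : ℕ → (maxNilIdealC F).toIdeal) (hw : ∀ n, AinfTop.mulPC F p E₀ (w (n + 1)) = w n)
        (_ : ∀ n, ‖(((w n : (maxNilIdealC F).toIdeal) : CBall F) : CompletedAlgClosure F) -
      (((AinfTop.seqO (W.map ψ) τ n : (maxNilIdealC F).toIdeal) : CBall F) : CompletedAlgClosure F)‖ ≤ ‖((D.rootC : integerC F) : CompletedAlgClosure F)‖)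
        (z : bmaxZero F p), algebraMap (Ainf (p := p) F) (bmaxZero F p)
        ((AinfTop.of F p).symm (((AinfTop.divisionLiftPt E₀ hθ w hw).val : (AinfTop.nilTheta F p hθ).toIdeal) : AinfTop F p)) ^ N =
      (p : bmaxZero F p) * z →
        LT τ = PadicLogSeries.logSum ((algebraMap (Ainf (p := p) F) (bmaxZero F p)).comp zpToAinf) (GaloisContinuity.formalLogNum E₀ p) N
          (algebraMap (Ainf (p := p) F) (bmaxZero F p)
            ((AinfTop.of F p).symm (((AinfTop.divisionLiftPt E₀ hθ w hw).val : (AinfTop.nilTheta F p hθ).toIdeal) : AinfTop F p))) z)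
    (S U : AinfTop.TatePtO F (W.map ψ) p) :
    frobBmaxPlus F p (LT S * frobBmaxPlus F p (LT U) - frobBmaxPlus F p (LT S) * LT U) =
      (p : BmaxPlus F p) * (LT S * frobBmaxPlus F p (LT U) - frobBmaxPlus F p (LT S) * LT U) := by
  obtain ⟨w, ⟨hw, hwv⟩, -⟩ := exists_unique_transport_seqO D W E₀ hWE ψ hψ S
  obtain ⟨w', ⟨hw', hw'v⟩, -⟩ := exists_unique_transport_seqO D W E₀ hWE ψ hψ U
  have hofp : AdicCompletion.of (Ideal.span {(p : bmaxZero F p)}) (bmaxZero F p) (p : bmaxZero F p) = (p : BmaxPlus F p) :=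
    map_natCast (algebraMap (bmaxZero F p) (BmaxPlus F p)) p
  have hR := frobBmaxPlus_hondaTrace_transport_eq_zero D W E₀ ψ (hθ := hθ) hN hLT S hw hwv
  have hR' := frobBmaxPlus_hondaTrace_transport_eq_zero D W E₀ ψ (hθ := hθ) hN hLT U hw' hw'v
  rw [hofp] at hR hR'
  exact PadicLogSeries.frob_det_eq_mul_det (frobBmaxPlus F p) hR hR'

include hWE hψ in
set_option maxHeartbeats 1600000 in
/-- ★★ **`θ(D) = 0 ⟹ p^k·D = ι(c)·t` with `c ∈ ℤ_p`** for the transported Legendre determinant (Fontaine's lemma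
`(A_max)^{φ=p} ∩ ker θ = ℚ_p·t ∩ A_max`, `fontaineKernel'`, every prime). Unlike the φ-road on torsion towers, `θ(D) = 0` is NOT automatic here
(`θ(LT τ) ≠ 0` in general); it is supplied by the Hodge line (§3). [cite: FontaineAsterisque223III, Exp. III Th. 5.3.7]
[cite: Colmez1992PeriodesAbeliennes, §2] -/
theorem exists_pow_mul_transport_det_eq_tBmax (hF : Function.Surjective (fontaineTheta (integerC F) p))
    [(E₀.map (Int.castRingHom ℚ_[p])).IsElliptic] [(E₀.map (Int.castRingHom (ZMod p))).IsElliptic]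
    {N : ℕ} (hN : D.e ≤ N) {LT : AinfTop.TatePtO F (W.map ψ) p →+ BmaxPlus F p}
    (hLT : ∀ (τ : AinfTop.TatePtO F (W.map ψ) p) (w : ℕ → (maxNilIdealC F).toIdeal) (hw : ∀ n, AinfTop.mulPC F p E₀ (w (n + 1)) = w n)
        (_ : ∀ n, ‖(((w n : (maxNilIdealC F).toIdeal) : CBall F) : CompletedAlgClosure F) -
      (((AinfTop.seqO (W.map ψ) τ n : (maxNilIdealC F).toIdeal) : CBall F) : CompletedAlgClosure F)‖ ≤ ‖((D.rootC : integerC F) : CompletedAlgClosure F)‖)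
        (z : bmaxZero F p), algebraMap (Ainf (p := p) F) (bmaxZero F p)
        ((AinfTop.of F p).symm (((AinfTop.divisionLiftPt E₀ hθ w hw).val : (AinfTop.nilTheta F p hθ).toIdeal) : AinfTop F p)) ^ N =
      (p : bmaxZero F p) * z →
        LT τ = PadicLogSeries.logSum ((algebraMap (Ainf (p := p) F) (bmaxZero F p)).comp zpToAinf) (GaloisContinuity.formalLogNum E₀ p) N
          (algebraMap (Ainf (p := p) F) (bmaxZero F p)
            ((AinfTop.of F p).symm (((AinfTop.divisionLiftPt E₀ hθ w hw).val : (AinfTop.nilTheta F p hθ).toIdeal) : AinfTop F p))) z)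
    (S U : AinfTop.TatePtO F (W.map ψ) p)
    (h0 : thetaBmaxPlus F p (LT S * frobBmaxPlus F p (LT U) - frobBmaxPlus F p (LT S) * LT U) = 0) :
    ∃ (k : ℕ) (c : ℤ_[p]), (p : BmaxPlus F p) ^ k * (LT S * frobBmaxPlus F p (LT U) - frobBmaxPlus F p (LT S) * LT U) =
      ainfToBmaxPlus F p (zpToAinf c) * tBmax :=
  fontaineKernel' hF (frobBmaxPlus_transport_det D W E₀ hWE ψ hψ (hθ := hθ) hN hLT S U) h0

include hWE hψ in
set_option maxHeartbeats 1600000 in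
/-- ★★ **The same in `B_dR⁺` for `P⁰ = f∘LT`, `Q⁰ = f∘φ∘LT`**: if `θ_dR(P⁰S·Q⁰U − Q⁰S·P⁰U) = 0` then
**`p^k·(P⁰S·Q⁰U − Q⁰S·P⁰U) = c·t_dR`** with `c ∈ ℤ_p` — so the Legendre constant of the transported pair is `ℚ_p`-rational, as for the φ-road
(`BmaxPlusPhiRoadReciprocity.exists_sq_mul_phiRoad_det_eq`). [cite: FontaineAsterisque223III, Exp. III Th. 5.3.7] [cite: Kato1993LNM1553, Ch. II §1.4] -/
theorem exists_pow_mul_transported_det_eq_tBdR (hF : Function.Surjective (fontaineTheta (integerC F) p))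
    [(E₀.map (Int.castRingHom ℚ_[p])).IsElliptic] [(E₀.map (Int.castRingHom (ZMod p))).IsElliptic]
    {N : ℕ} (hN : D.e ≤ N) {LT : AinfTop.TatePtO F (W.map ψ) p →+ BmaxPlus F p} {P₀ Q₀ : AinfTop.TatePtO F (W.map ψ) p →+ BdRPlusTop F p}
    (hLT : ∀ (τ : AinfTop.TatePtO F (W.map ψ) p) (w : ℕ → (maxNilIdealC F).toIdeal) (hw : ∀ n, AinfTop.mulPC F p E₀ (w (n + 1)) = w n)
        (_ : ∀ n, ‖(((w n : (maxNilIdealC F).toIdeal) : CBall F) : CompletedAlgClosure F) -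
      (((AinfTop.seqO (W.map ψ) τ n : (maxNilIdealC F).toIdeal) : CBall F) : CompletedAlgClosure F)‖ ≤ ‖((D.rootC : integerC F) : CompletedAlgClosure F)‖)
        (z : bmaxZero F p), algebraMap (Ainf (p := p) F) (bmaxZero F p)
        ((AinfTop.of F p).symm (((AinfTop.divisionLiftPt E₀ hθ w hw).val : (AinfTop.nilTheta F p hθ).toIdeal) : AinfTop F p)) ^ N =
      (p : bmaxZero F p) * z →
        LT τ = PadicLogSeries.logSum ((algebraMap (Ainf (p := p) F) (bmaxZero F p)).comp zpToAinf) (GaloisContinuity.formalLogNum E₀ p) N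
          (algebraMap (Ainf (p := p) F) (bmaxZero F p)
            ((AinfTop.of F p).symm (((AinfTop.divisionLiftPt E₀ hθ w hw).val : (AinfTop.nilTheta F p hθ).toIdeal) : AinfTop F p))) z)
    (hP₀ : ∀ τ, P₀ τ = BdRPlusTop.of F p (bmaxPlusToBdR F p (LT τ)))
    (hQ₀ : ∀ τ, Q₀ τ = BdRPlusTop.of F p (bmaxPlusToBdR F p (frobBmaxPlus F p (LT τ))))
    (S U : AinfTop.TatePtO F (W.map ψ) p) (h0 : thetaBdR ((BdRPlusTop.of F p).symm (P₀ S * Q₀ U - Q₀ S * P₀ U)) = 0) :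
    ∃ (k : ℕ) (c : ℤ_[p]), (p : BdRPlusTop F p) ^ k * (P₀ S * Q₀ U - Q₀ S * P₀ U) =
      BdRPlusTop.of F p (qpToBdR (c : ℚ_[p])) * BdRPlusTop.of F p tBdR := by
  have hdet : P₀ S * Q₀ U - Q₀ S * P₀ U =
      BdRPlusTop.of F p (bmaxPlusToBdR F p (LT S * frobBmaxPlus F p (LT U) - frobBmaxPlus F p (LT S) * LT U)) := by
    rw [hP₀, hP₀, hQ₀, hQ₀]; simp only [map_mul, map_sub]
  have hθ0 : thetaBmaxPlus F p (LT S * frobBmaxPlus F p (LT U) - frobBmaxPlus F p (LT S) * LT U) = 0 := by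
    rw [hdet, RingEquiv.symm_apply_apply, thetaBdR_bmaxPlusToBdR] at h0
    exact Subtype.ext (by rw [h0]; rfl)
  obtain ⟨k, c, hk⟩ := exists_pow_mul_transport_det_eq_tBmax D W E₀ hWE ψ hψ (hθ := hθ) hF hN hLT S U hθ0
  refine ⟨k, c, ?_⟩
  have h := congrArg (fun x => BdRPlusTop.of F p (bmaxPlusToBdR F p x)) hk
  simp only [map_mul, map_pow, map_natCast, bmaxPlusToBdR_ainfToBmaxPlus_zpToAinf, bmaxPlusToBdR_tBmax] at h
  rw [hdet]
  simp only [map_mul, map_sub]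
  simpa only [map_mul, map_sub] using h

/-! ## §3 `θ(D) = 0` from the Hodge line -/

/-- **`θ_dR(P⁰S·Q⁰U − Q⁰S·P⁰U) = 0` from the Hodge line**: if `a·θ_dR(P⁰τ) + b·θ_dR(Q⁰τ) = 0` for all `τ` with `(a, b) ≠ 0` in `ℂ_F` (the
(HL-eval) identity on torsion towers), then every minor has `θ_dR = 0` (§1 in the field `ℂ_F`). [cite: Kato1993LNM1553, Ch. II §1.4] -/
theorem thetaBdR_transported_det_eq_zero_of_hodgeLine {T : Type*} (P₀ Q₀ : T → BdRPlusTop F p) {a b : CompletedAlgClosure F}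
    (hab : a ≠ 0 ∨ b ≠ 0)
    (hHL : ∀ τ, a * thetaBdR ((BdRPlusTop.of F p).symm (P₀ τ)) + b * thetaBdR ((BdRPlusTop.of F p).symm (Q₀ τ)) = 0) (S U : T) :
    thetaBdR ((BdRPlusTop.of F p).symm (P₀ S * Q₀ U - Q₀ S * P₀ U)) = 0 := by
  rw [map_sub, map_mul, map_mul, map_sub, map_mul, map_mul]
  exact sub_mul_eq_zero_of_two_solutions (hHL S) (hHL U) hab

/-! ## §4 `hne` for the Hodge pair ⟸ `D ≢ 0`; the case `B = 0` -/

/-- ★ **`hne ⟸ D ≢ 0`**: if some transported minor `P⁰S·Q⁰U − Q⁰S·P⁰U` is nonzero (`θ` surjective, so `B_dR⁺` is a domain), then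
`A·P⁰ + B·Q⁰ ≢ 0` for every pair of scalars `(A, B) ≠ 0` — in particular for the cells' Hodge pair `Pω″ = A·P⁰ + B·Q⁰`.
[cite: Kato1993LNM1553, Ch. II §1.4] [cite: Colmez1992PeriodesAbeliennes, §2] -/
theorem exists_hodgePair_ne_zero_of_det_ne_zero (hF : Function.Surjective (fontaineTheta (integerC F) p)) {T : Type*}
    (P₀ Q₀ : T → BdRPlusTop F p) {A B : BdRPlusTop F p} (hAB : A ≠ 0 ∨ B ≠ 0) {S U : T} (hdet : P₀ S * Q₀ U - Q₀ S * P₀ U ≠ 0) :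
    ∃ τ, A * P₀ τ + B * Q₀ τ ≠ 0 := by
  haveI : IsDomain (BdRPlusTop F p) := isDomain_bDeRhamPlus (F := F) (p := p) hF
  exact exists_add_mul_ne_zero_of_det_ne_zero P₀ Q₀ hAB hdet

include hWE hψ in
set_option maxHeartbeats 1600000 in
/-- ★ **The case `B = 0` of `hne` is free: `P⁰ τ ≠ 0` for every `τ ≠ 0`** (`E₀` good supersingular at `p ≥ 5`): `P⁰ τ = 0` would give `LT τ = 0`,
hence `θ(LT τ) = 0 = θ(φ LT τ)`, contradicting `thetaBmaxPlus_frobBmaxPlus_logSum_transport_ne_zero`.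
[cite: Tate1967, §4] [cite: FontaineAsterisque223III, Exp. III Prop. 5.1.3] -/
theorem transported_P₀_ne_zero (hpv : valuation F p < 1) (hp5 : 5 ≤ p) (hΔ : ¬ (p : ℤ) ∣ E₀.Δ)
    (hA : (E₀.map (Int.castRingHom (ZMod p))).hasseCoeff p = 0) [(E₀.map (Int.castRingHom ℚ_[p])).IsElliptic]
    [(E₀.map (Int.castRingHom (ZMod p))).IsElliptic] [(curveOver (CompletedAlgClosure F) E₀).IsElliptic]
    {N : ℕ} (hN : D.e ≤ N) {LT : AinfTop.TatePtO F (W.map ψ) p →+ BmaxPlus F p} {P₀ : AinfTop.TatePtO F (W.map ψ) p →+ BdRPlusTop F p}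
    (hLT' : ∀ (τ : AinfTop.TatePtO F (W.map ψ) p) (w : ℕ → (maxNilIdealC F).toIdeal) (hw : ∀ n, AinfTop.mulPC F p E₀ (w (n + 1)) = w n)
        (_ : ∀ n, ‖(((w n : (maxNilIdealC F).toIdeal) : CBall F) : CompletedAlgClosure F) -
      (((AinfTop.seqO (W.map ψ) τ n : (maxNilIdealC F).toIdeal) : CBall F) : CompletedAlgClosure F)‖ ≤ ‖((D.rootC : integerC F) : CompletedAlgClosure F)‖)
        (z : bmaxZero F p), algebraMap (Ainf (p := p) F) (bmaxZero F p)
        ((AinfTop.of F p).symm (((AinfTop.divisionLiftPt E₀ hθ w hw).val : (AinfTop.nilTheta F p hθ).toIdeal) : AinfTop F p)) ^ N =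
      (p : bmaxZero F p) * z →
        LT τ = PadicLogSeries.logSum ((algebraMap (Ainf (p := p) F) (bmaxZero F p)).comp zpToAinf) (GaloisContinuity.formalLogNum E₀ p) N
          (algebraMap (Ainf (p := p) F) (bmaxZero F p)
            ((AinfTop.of F p).symm (((AinfTop.divisionLiftPt E₀ hθ w hw).val : (AinfTop.nilTheta F p hθ).toIdeal) : AinfTop F p))) z)
    (hP₀ : ∀ τ, P₀ τ = BdRPlusTop.of F p (bmaxPlusToBdR F p (LT τ)))
    (τ : AinfTop.TatePtO F (W.map ψ) p) (hτ : τ ≠ 0) : P₀ τ ≠ 0 := by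
  obtain ⟨w, ⟨hw, hwv⟩, -⟩ := exists_unique_transport_seqO D W E₀ hWE ψ hψ τ
  obtain ⟨z, hz⟩ := exists_witness_transport D W E₀ ψ τ hw hwv hN (hθ := hθ)
  intro h0
  have hLT : LT τ = 0 := bmaxPlusToBdR_injective hθ (by
    rw [map_zero]; exact (BdRPlusTop.of F p).injective (by rw [← hP₀, h0, map_zero]))
  have h1 : thetaBmaxPlus F p (LT τ) = 0 := by rw [hLT, map_zero]
  have h2 : thetaBmaxPlus F p (frobBmaxPlus F p (LT τ)) = 0 := by rw [hLT, map_zero, map_zero]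
  rw [hLT' τ w hw hwv z hz] at h1 h2
  exact thetaBmaxPlus_frobBmaxPlus_logSum_transport_ne_zero D W E₀ ψ hψ (hθ := hθ) hpv hp5 hΔ hA τ hτ hw hwv hN hz h1 h2

end Transported

end Literature.NumberTheory.PAdicHodge
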